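import Literature.Computability.FineGrained.FineGrainedWave0
import Literature.Computability.Complexity.ProbabilisticClassesProofs
import Mathlib.Data.Nat.Size
import Mathlib.Data.Nat.Choose.Sum
import HarnessLib

/-!
# Schöning's random-walk algorithm for `k`-SAT as a coin-string function, I: the algorithm and counting tools

Topic `Literature/Computability/FineGrained`; first file of a line of work (sub-namespace
`SchoeningCoin`) towards the discharge of the named fact
`Literature.Computability.FineGrained.schoening` (`SatAlgorithms.lean`: for `k ≥ 3`, `k`-SAT is in
bounded-error randomized time `(2 - 2/k)^n · poly(L)`; Schöning, FOCS 1999, Theorem) that is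
independent of, and differently organised from, the sibling `SchoeningWalk.lean` (namespace
`Schoening`: real-valued averages, a gambler's-ruin estimate for the lazy walk with `k` coins per
step): here everything is integer counting, the walk reads `⌈log₂ k⌉ + O(1)` coins per step, and
the binomial estimates are done by the mode inequality (part II). This file is machine-free: it defines the algorithm as a *function of the coin string* — exactly the
function the multi-stack machine of the sequel files computes — proves its one-sided error, and
sets up the elementary counting tools (`uniformProb m E = cnt m E / 2^m`, `CoinCounting.lean`) used
by the probability analysis of `SchoeningCoinBound.lean`.

## The algorithm (`run`)

Assignments are kept as *literal lists* `L : List (ℕ × Bool)` read by first match (`Asg.val`,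
default `false`), so that a flip of `x` is the prepending of `(x, ¬ value)` and the initial random
assignment is obtained by prepending `(x, coin)` for every *occurrence* of a variable `x` in the
formula, in order (`initL`; the value of `x` is then the coin of its last occurrence, a uniformly
distributed assignment of the occurring variables). Coins are read from the front of the coin
string, an exhausted string reading as `false` (`popD`). One restart (`restart`) is `initL`
followed by `S` steps of the walk (`walk`): if the current assignment satisfies `φ`, stop with
success; otherwise read `d` coins as a number `u < 2^d` (`readU`, least significant coin first),
take the first violated clause `C` (`viol`) and, if `u < |C|`, flip the variable of its `u`-th
literal (`stepL`) — for `|C| ≤ u` nothing is flipped (a *lazy* step: with `2^d ≥ k` this is how a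
uniform choice among `k` slots is made from coin *bits*, which cannot produce probability `1/k`
exactly). The whole algorithm (`run`) pops one further coin per restart (the loop of the machine
is driven by the coin register) and restarts until the coins are exhausted. Parameters:
`d = Nat.size k` (`dOf`, `k < 2^d ≤ 2k`), `S = 2k · #occurrences + 1` (`sOf`), and
`cpr = #occurrences + S d` coins per complete restart. Unsatisfiable inputs are always rejected
(`run_eq_false_of_not_satisfiable`).

## Counting tools

`lsum a f` (the sum of `f` over all coin blocks of length `a`, by recursion) with
`cnt_add_eq_lsum` (splitting off a prefix block), `cnt_take` (with the tree's `cnt_take_drop` of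
`ProbabilisticClassesProofs.lean`: independent blocks), `cnt_blocks` (consecutive blocks multiply;
the same statement is proved in `IsolationAdvice.lean`, whose import closure — Stockmeyer,
Valiant–Vazirani — we keep out of the fine-grained files), `lsum_bval` (a block as a number
`< 2^a`);
the three step classes `Cls` (good / lazy / other) with their sizes `1, N - k, k - 1` among the
numbers `u < N` (`sum_range_clsOf`), class words, their `weight`, and `wsum m F` (the sum over all
class words of length `m`) with `wsum_weight : wsum m weight = N^m`.

## References

* U. Schöning, *A probabilistic algorithm for k-SAT and constraint satisfaction problems*, Proc.
  40th FOCS (1999) 410–414, Theorem and its proof (the random walk with restarts)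
  [key `SchoeningFOCS1999`; not held (paywalled, acquisition requested 2026-08-15); the algorithm
  and its analysis read in the two textbooks below].
* U. Schöning, J. Torán, *The Satisfiability Problem: Algorithms and Analyses*, Lehmanns 2013,
  §5.4 "A Random Walk Algorithm", the displayed algorithm and the Theorem ("there is a probabilistic
  algorithm for k-SAT with running time `O*((2(1 - 1/k))^n)`") [key `SchoeningToran2013`; read
  2026-08-15 (galaxy panama:60215441490023, chunks 103–105)].
* J. Hromkovič, *Algorithmics for Hard Problems*, Springer 2001, §5.3.7, Algorithm 5.3.7.1
  (SCHÖNING'S ALGORITHM), Theorem 5.3.7.2 (3-SAT), Exercise 5.3.7.3 (general `k`, `(2 - 2/k)^n`)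
  [key `Hromkovic2001`; held, read 2026-08-15, pp. 417–420].
-/

namespace Literature.Computability.FineGrained.SchoeningCoin

open _root_.Computability Complexity

variable {k : ℕ}

/-! ### Assignments as literal lists -/

/-- Assignments kept as literal lists `[(x₁, v₁), (x₂, v₂), …]`, read by first match. [folklore] -/
abbrev Asg : Type := List (ℕ × Bool)

/-- The value of `x` under the literal list `L`: the Boolean of the first pair on `x`, `false` if
there is none. (The same reading as `IPRenameM.lookupB` of the machine toolkit.) [folklore] -/
def Asg.val (L : Asg) (x : ℕ) : Bool := ((L.find? fun l => l.1 == x).map Prod.snd).getD false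

/-- The empty list assigns `false`. [folklore] -/
@[simp] theorem Asg.val_nil (x : ℕ) : Asg.val [] x = false := rfl

/-- Reading a cons: the head pair decides its own variable. [folklore] -/
@[simp] theorem Asg.val_cons (y : ℕ) (b : Bool) (L : Asg) (x : ℕ) :
    Asg.val ((y, b) :: L) x = if y = x then b else L.val x := by
  unfold Asg.val
  rw [List.find?_cons]
  by_cases h : y = x
  · simp [h]
  · rw [beq_false_of_ne h, if_neg h]

/-- Reading an append: the first list wins where it has a pair on `x`. [folklore] -/
theorem Asg.val_append (L₁ L₂ : Asg) (x : ℕ) :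
    Asg.val (L₁ ++ L₂) x = if (L₁.any fun l => l.1 == x) then L₁.val x else L₂.val x := by
  induction L₁ with
  | nil => simp
  | cons l L₁ ih =>
    obtain ⟨y, b⟩ := l
    rw [List.cons_append, Asg.val_cons, ih, List.any_cons, Asg.val_cons]
    by_cases h : y = x
    · simp [h]
    · simp [h]

/-! ### The formula: occurrences, violated clauses, evaluation -/

/-- The occurrences of variables in `φ`, in reading order (with repetitions). [folklore] -/
def occs (φ : KCNF k) : List ℕ := φ.clauses.flatMap fun c => c.map Prod.fst

/-- The first clause of `φ` violated by `v` (all its literals false), if any. [folklore] -/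
def viol (φ : KCNF k) (v : ℕ → Bool) : Option (List (ℕ × Bool)) :=
  φ.clauses.find? fun c => c.all fun l => !(v l.1 == l.2)

/-- `φ` is true under `v` iff no clause is violated. [folklore] -/
theorem eval_eq_true_iff_viol_eq_none (φ : KCNF k) (v : ℕ → Bool) :
    φ.eval v = true ↔ viol φ v = none := by
  unfold viol KCNF.eval
  rw [List.find?_eq_none, List.all_eq_true]
  refine forall₂_congr fun c _ => ?_
  rw [List.any_eq_true]
  constructor
  · rintro ⟨l, hl, h⟩ hall
    rw [List.all_eq_true] at hall
    have := hall l hl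
    simp [h] at this
  · intro h
    by_contra hne
    apply h
    rw [List.all_eq_true]
    intro l hl
    have : ¬ (v l.1 == l.2) = true := fun h' => hne ⟨l, hl, h'⟩
    simpa using this

/-- A violated clause is a clause of `φ` all of whose literals are false. [folklore] -/
theorem viol_eq_some {φ : KCNF k} {v : ℕ → Bool} {c : List (ℕ × Bool)} (h : viol φ v = some c) :
    c ∈ φ.clauses ∧ ∀ l ∈ c, v l.1 ≠ l.2 := by
  unfold viol at h
  refine ⟨List.mem_of_find?_eq_some h, fun l hl => ?_⟩
  have := List.find?_some h
  rw [List.all_eq_true] at this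
  have := this l hl
  simpa using this

/-- The value of `φ` depends only on the values of the occurring variables. [folklore] -/
theorem eval_congr_occs (φ : KCNF k) {v w : ℕ → Bool} (h : ∀ x ∈ occs φ, v x = w x) :
    φ.eval v = φ.eval w := by
  unfold KCNF.eval
  have : ∀ c ∈ φ.clauses, (c.any fun l => v l.1 == l.2) = (c.any fun l => w l.1 == l.2) := by
    intro c hc
    rw [Bool.eq_iff_iff, List.any_eq_true, List.any_eq_true]
    refine exists_congr fun l => and_congr_right fun hl => ?_
    rw [h l.1 (List.mem_flatMap.2 ⟨c, hc, List.mem_map.2 ⟨l, hl, rfl⟩⟩)]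
  rw [Bool.eq_iff_iff, List.all_eq_true, List.all_eq_true]
  exact forall₂_congr fun c hc => by rw [this c hc]

/-- A satisfying assignment in the sense of `KCNF.Satisfiable` gives a total one. [folklore] -/
theorem exists_eval_of_satisfiable {φ : KCNF k} (h : φ.Satisfiable) : ∃ a : ℕ → Bool, φ.eval a = true := by
  obtain ⟨v, hv⟩ := h
  exact ⟨_, hv⟩

/-- A total satisfying assignment gives `KCNF.Satisfiable`. [folklore] -/
theorem satisfiable_of_eval {φ : KCNF k} {a : ℕ → Bool} (h : φ.eval a = true) : φ.Satisfiable := by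
  refine ⟨fun i => a i, ?_⟩
  rw [← h]
  apply eval_congr_occs
  intro x hx
  obtain ⟨c, hc, hx⟩ := List.mem_flatMap.1 hx
  obtain ⟨l, hl, rfl⟩ := List.mem_map.1 hx
  simp [φ.fst_lt_numVars c hc l hl]

/-! ### One step of the walk -/

/-- Flip the variable `x`: prepend the opposite of its current value. [folklore] -/
def flipVar (L : Asg) (x : ℕ) : Asg := (x, !L.val x) :: L

/-- Values after a flip. [folklore] -/
@[simp] theorem val_flipVar (L : Asg) (x y : ℕ) :
    (flipVar L x).val y = if x = y then !L.val y else L.val y := by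
  unfold flipVar
  rw [Asg.val_cons]
  by_cases h : x = y
  · subst h; simp
  · simp [h]

/-- One step of Schöning's walk with the random number `u`: if some clause is violated, take the
first one, `C`, and flip the variable of its `u`-th literal when `u < |C|` (nothing otherwise).
[cite: SchoeningFOCS1999, Theorem (the algorithm)] -/
def stepL (φ : KCNF k) (L : Asg) (u : ℕ) : Asg :=
  match viol φ L.val with
  | none => L
  | some c => if h : u < c.length then flipVar L (c.get ⟨u, h⟩).1 else L

/-- A satisfied assignment is not moved. [folklore] -/
theorem stepL_of_eval {φ : KCNF k} {L : Asg} (h : φ.eval L.val = true) (u : ℕ) : stepL φ L u = L := by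
  unfold stepL
  rw [(eval_eq_true_iff_viol_eq_none φ _).1 h]

/-! ### Reading coins -/

/-- Pop one coin; an exhausted coin string reads as `false`. [folklore] -/
def popD : List Bool → Bool × List Bool
  | [] => (false, [])
  | b :: r => (b, r)

/-- `popD` on a cons. [folklore] -/
@[simp] theorem popD_cons (b : Bool) (r : List Bool) : popD (b :: r) = (b, r) := rfl
/-- `popD` on the empty string. [folklore] -/
@[simp] theorem popD_nil : popD [] = (false, []) := rfl

/-- `popD` shortens the string by at most one. [folklore] -/
theorem length_popD (r : List Bool) : (popD r).2.length = r.length - 1 := by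
  cases r <;> simp

/-- Read `d` coins as a number `< 2^d`, least significant coin first. [folklore] -/
def readU : ℕ → List Bool → ℕ × List Bool
  | 0, r => (0, r)
  | d + 1, r => ((popD r).1.toNat + 2 * (readU d (popD r).2).1, (readU d (popD r).2).2)

/-- The value of a coin block, least significant coin first. [folklore] -/
def bval : List Bool → ℕ
  | [] => 0
  | b :: w => b.toNat + 2 * bval w

/-- `bval` of a cons. [folklore] -/
@[simp] theorem bval_cons (b : Bool) (w : List Bool) : bval (b :: w) = b.toNat + 2 * bval w := rfl
/-- `bval` of nil. [folklore] -/
@[simp] theorem bval_nil : bval [] = 0 := rfl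

/-- `bval w < 2^|w|`. [folklore] -/
theorem bval_lt (w : List Bool) : bval w < 2 ^ w.length := by
  induction w with
  | nil => simp
  | cons b w ih => cases b <;> simp [pow_succ] <;> omega

/-- Reading a full block in front of `r`: the value of the block, and `r`. [folklore] -/
theorem readU_append (w r : List Bool) : readU w.length (w ++ r) = (bval w, r) := by
  induction w with
  | nil => rfl
  | cons b w ih => simp [readU, ih]

/-- Reading a block of length `d` in front of `r`. [folklore] -/
theorem readU_append' {d : ℕ} (w r : List Bool) (hw : w.length = d) : readU d (w ++ r) = (bval w, r) := by
  rw [← hw]; exact readU_append w r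

/-- `readU d` consumes at most `d` coins (exactly `d` when available). [folklore] -/
theorem length_readU : ∀ (d : ℕ) (r : List Bool), (readU d r).2.length = r.length - d
  | 0, r => by simp [readU]
  | d + 1, r => by
    rw [readU, length_readU d, length_popD]
    omega

/-! ### Initialisation, walk, restart, run -/

/-- The random initial assignment: one coin per occurrence, prepended (so the value of a variable is
the coin of its *last* occurrence). [cite: SchoeningFOCS1999, Theorem (the algorithm: "guess an initial assignment uniformly at random")] -/
def initL : List ℕ → Asg → List Bool → Asg × List Bool
  | [], L, r => (L, r)
  | x :: xs, L, r => initL xs ((x, (popD r).1) :: L) (popD r).2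

/-- `initL` consumes one coin per occurrence (while available). [folklore] -/
theorem length_initL : ∀ (xs : List ℕ) (L : Asg) (r : List Bool),
    (initL xs L r).2.length = r.length - xs.length
  | [], L, r => by simp [initL]
  | x :: xs, L, r => by
    rw [initL, length_initL xs, length_popD]
    simp only [List.length_cons]
    omega

/-- `initL` on a full coin block in front of `r`: the zipped block, reversed, on top of `L`; and `r`.
[folklore] -/
theorem initL_append : ∀ (xs : List ℕ) (L : Asg) (w r : List Bool), w.length = xs.length →
    initL xs L (w ++ r) = ((xs.zip w).reverse ++ L, r)
  | [], L, [], r, _ => by simp [initL]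
  | x :: xs, L, b :: w, r, h => by
    rw [List.cons_append, initL, popD_cons, initL_append xs _ w r (by simpa using h)]
    simp

/-- The walk of at most `S` steps from `L`: success as soon as the current assignment satisfies
`φ`; otherwise read `d` coins and step. Returns the success bit and the unread coins.
[cite: SchoeningFOCS1999, Theorem (the algorithm: the inner loop)] -/
def walk (φ : KCNF k) (d : ℕ) : ℕ → Asg → List Bool → Bool × List Bool
  | 0, _, r => (false, r)
  | s + 1, L, r =>
    if φ.eval L.val then (true, r) else walk φ d s (stepL φ L (readU d r).1) (readU d r).2

/-- The walk consumes coins from the front. [folklore] -/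
theorem length_walk (φ : KCNF k) (d : ℕ) : ∀ (s : ℕ) (L : Asg) (r : List Bool),
    (walk φ d s L r).2.length ≤ r.length
  | 0, L, r => le_rfl
  | s + 1, L, r => by
    unfold walk
    split_ifs
    · exact le_rfl
    · exact (length_walk φ d s _ _).trans (by rw [length_readU]; omega)

/-- One restart: a fresh random assignment of the occurring variables, then the walk.
[cite: SchoeningFOCS1999, Theorem (the algorithm: one iteration of the outer loop)] -/
def restart (φ : KCNF k) (d S : ℕ) (r : List Bool) : Bool × List Bool :=
  walk φ d S (initL (occs φ) [] r).1 (initL (occs φ) [] r).2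

/-- A restart consumes coins from the front. [folklore] -/
theorem length_restart (φ : KCNF k) (d S : ℕ) (r : List Bool) :
    (restart φ d S r).2.length ≤ r.length := by
  unfold restart
  exact (length_walk φ d S _ _).trans (by rw [length_initL]; omega)

/-- **Schöning's algorithm on a coin string**: pop one coin per restart (the loop of the machine is
driven by the coin register) and restart until the coins are exhausted; accept iff some restart
found a satisfying assignment. [cite: SchoeningFOCS1999, Theorem (the algorithm)] -/
def run (φ : KCNF k) (d S : ℕ) : List Bool → Bool
  | [] => false
  | _ :: r => (restart φ d S r).1 || run φ d S (restart φ d S r).2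
termination_by r => r.length
decreasing_by
  have := length_restart φ d S r
  simp only [List.length_cons]
  omega

/-- `run` on the empty string. [folklore] -/
@[simp] theorem run_nil (φ : KCNF k) (d S : ℕ) : run φ d S [] = false := by
  rw [run]

/-- `run` unrolled once. [folklore] -/
theorem run_cons (φ : KCNF k) (d S : ℕ) (b : Bool) (r : List Bool) :
    run φ d S (b :: r) = ((restart φ d S r).1 || run φ d S (restart φ d S r).2) := by
  rw [run]

/-! ### Parameters -/

/-- The number of coins read per step: `d = size k`, so that `k < 2^d ≤ 2k`. [folklore] -/
def dOf (k : ℕ) : ℕ := Nat.size k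

/-- `k < 2^(dOf k)`. [folklore] -/
theorem lt_two_pow_dOf (k : ℕ) : k < 2 ^ dOf k := Nat.lt_size_self k

/-- `2^(dOf k) ≤ 2k` for `k ≥ 1`. [folklore] -/
theorem two_pow_dOf_le {k : ℕ} (hk : 1 ≤ k) : 2 ^ dOf k ≤ 2 * k := by
  unfold dOf
  have hpos : 0 < Nat.size k := Nat.size_pos.2 hk
  have h : 2 ^ (Nat.size k - 1) ≤ k := Nat.lt_size.1 (by omega)
  calc 2 ^ Nat.size k = 2 * 2 ^ (Nat.size k - 1) := by
        rw [← pow_succ']; congr 1; omega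
    _ ≤ 2 * k := Nat.mul_le_mul_left 2 h

/-- The number of steps of one walk: `S = 2k · #occurrences + 1`. [folklore] -/
def sOf (φ : KCNF k) : ℕ := 2 * k * (occs φ).length + 1

/-- The number of coins of a complete (failing) restart: one per occurrence, `d` per step. [folklore] -/
def cpr (φ : KCNF k) : ℕ := (occs φ).length + sOf φ * dOf k

/-! ### One-sided error -/

/-- A successful walk has found a satisfying assignment. [folklore] -/
theorem satisfiable_of_walk {φ : KCNF k} {d : ℕ} :
    ∀ {s : ℕ} {L : Asg} {r : List Bool}, (walk φ d s L r).1 = true → φ.Satisfiable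
  | 0, L, r, h => by simp [walk] at h
  | s + 1, L, r, h => by
    unfold walk at h
    split_ifs at h with he
    · exact satisfiable_of_eval he
    · exact satisfiable_of_walk h

/-- **One-sided error**: an unsatisfiable formula is always rejected. [cite: SchoeningFOCS1999, Theorem (proof: "if F is unsatisfiable the algorithm never accepts")] -/
theorem run_eq_false_of_not_satisfiable {φ : KCNF k} (h : ¬ φ.Satisfiable) (d S : ℕ) :
    ∀ r : List Bool, run φ d S r = false := by
  suffices H : ∀ (n : ℕ) (r : List Bool), r.length ≤ n → run φ d S r = false from
    fun r => H _ r le_rfl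
  intro n
  induction n with
  | zero =>
    intro r hr
    rw [List.eq_nil_of_length_eq_zero (Nat.le_zero.1 hr), run_nil]
  | succ n ih =>
    intro r hr
    cases r with
    | nil => rw [run_nil]
    | cons b r =>
      rw [run_cons]
      have h1 : (restart φ d S r).1 = false := by
        cases hb : (restart φ d S r).1
        · rfl
        · unfold restart at hb
          exact absurd (satisfiable_of_walk hb) h
      rw [h1, Bool.false_or]
      refine ih _ ?_
      have := length_restart φ d S r
      simp only [List.length_cons] at hr
      omega


/-! ### Sums over all coin blocks of a given length -/

/-- `lsum a f`: the sum of `f w` over all coin blocks `w` of length `a` (by recursion on `a`, first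
coin outermost). [folklore] -/
def lsum : ℕ → (List Bool → ℕ) → ℕ
  | 0, f => f []
  | a + 1, f => lsum a (fun w => f (false :: w)) + lsum a (fun w => f (true :: w))

/-- `lsum` only looks at blocks of the right length. [folklore] -/
theorem lsum_congr : ∀ {a : ℕ} {f g : List Bool → ℕ}, (∀ w, w.length = a → f w = g w) →
    lsum a f = lsum a g
  | 0, f, g, h => h [] rfl
  | a + 1, f, g, h => by
    simp only [lsum]
    rw [lsum_congr (f := fun w => f (false :: w)) fun w hw => h _ (by simp [hw]),
      lsum_congr (f := fun w => f (true :: w)) fun w hw => h _ (by simp [hw])]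

/-- `lsum` is monotone. [folklore] -/
theorem lsum_mono : ∀ {a : ℕ} {f g : List Bool → ℕ}, (∀ w, w.length = a → f w ≤ g w) →
    lsum a f ≤ lsum a g
  | 0, f, g, h => h [] rfl
  | a + 1, f, g, h => by
    simp only [lsum]
    exact Nat.add_le_add (lsum_mono fun w hw => h _ (by simp [hw]))
      (lsum_mono fun w hw => h _ (by simp [hw]))

/-- `lsum` is additive. [folklore] -/
theorem lsum_add : ∀ (a : ℕ) (f g : List Bool → ℕ),
    lsum a (fun w => f w + g w) = lsum a f + lsum a g
  | 0, f, g => rfl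
  | a + 1, f, g => by
    simp only [lsum]
    rw [lsum_add a, lsum_add a]
    ring

/-- Constants come out of `lsum`. [folklore] -/
theorem lsum_mul : ∀ (a : ℕ) (c : ℕ) (f : List Bool → ℕ),
    lsum a (fun w => c * f w) = c * lsum a f
  | 0, c, f => rfl
  | a + 1, c, f => by
    simp only [lsum]
    rw [lsum_mul a, lsum_mul a]
    ring

/-- Constants come out of `lsum` (on the right). [folklore] -/
theorem lsum_mul' (a : ℕ) (c : ℕ) (f : List Bool → ℕ) :
    lsum a (fun w => f w * c) = lsum a f * c := by
  rw [mul_comm, ← lsum_mul]; exact lsum_congr fun w _ => mul_comm _ _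

/-- `lsum` of a constant: `2^a` blocks. [folklore] -/
theorem lsum_const : ∀ (a c : ℕ), lsum a (fun _ => c) = 2 ^ a * c
  | 0, c => by simp [lsum]
  | a + 1, c => by
    simp only [lsum]
    rw [lsum_const a, pow_succ]
    ring

/-- **Splitting off a prefix block**: `cnt (a + b) E = Σ_{w ∈ {0,1}^a} cnt b {r | w ++ r ∈ E}`.
[folklore] -/
theorem cnt_add_eq_lsum : ∀ (a b : ℕ) (E : Set (List Bool)),
    cnt (a + b) E = lsum a (fun w => cnt b {r | w ++ r ∈ E})
  | 0, b, E => by simp [lsum]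
  | a + 1, b, E => by
    rw [show a + 1 + b = (a + b) + 1 by omega, cnt_succ, cnt_add_eq_lsum a b, cnt_add_eq_lsum a b]
    rfl

/-- `cnt` as an `lsum` of the indicator. [folklore] -/
theorem cnt_eq_lsum (a : ℕ) (E : Set (List Bool)) [DecidablePred (· ∈ E)] :
    cnt a E = lsum a (fun w => if w ∈ E then 1 else 0) := by
  classical
  have h := cnt_add_eq_lsum a 0 E
  rw [Nat.add_zero] at h
  rw [h]
  refine lsum_congr fun w _ => ?_
  rw [cnt_zero]
  simp

/-- An event asking something of the first `a` coins only. [folklore] -/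
theorem cnt_take (a b : ℕ) (E : Set (List Bool)) :
    cnt (a + b) {y | y.take a ∈ E} = cnt a E * 2 ^ b := by
  have h := cnt_take_drop a b E Set.univ
  rw [cnt_univ] at h
  rw [← h]
  exact cnt_congr fun y _ => by simp

/-- **Consecutive blocks**: asking something of each of `F` consecutive blocks of length `B`
multiplies the counts. [folklore] -/
theorem cnt_blocks (B : ℕ) (OK : Set (List Bool)) : ∀ F : ℕ,
    cnt (F * B) {y | ∀ i < F, (y.drop (i * B)).take B ∈ OK} = cnt B OK ^ F
  | 0 => by
    classical
    rw [Nat.zero_mul, cnt_zero, pow_zero]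
    simp
  | F + 1 => by
    have ih := cnt_blocks B OK F
    rw [show (F + 1) * B = B + F * B by ring, pow_succ, mul_comm (cnt B OK ^ F), ← ih, ← cnt_take_drop]
    refine cnt_congr fun y _ => ?_
    simp only [Set.mem_setOf_eq]
    constructor
    · intro h
      refine ⟨by simpa using h 0 (Nat.succ_pos F), fun i hi => ?_⟩
      have := h (i + 1) (by omega)
      rwa [show (i + 1) * B = B + i * B by ring, ← List.drop_drop] at this
    · rintro ⟨h0, h⟩ i hi
      rcases i with _ | i
      · simpa using h0
      · have := h i (by omega)
        rwa [show (i + 1) * B = B + i * B by ring, ← List.drop_drop]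

/-- `lsum` over a block of the value of the block: a sum over the numbers `< 2^a`. [folklore] -/
theorem lsum_bval : ∀ (a : ℕ) (f : ℕ → ℕ),
    lsum a (fun w => f (bval w)) = ∑ u ∈ Finset.range (2 ^ a), f u
  | 0, f => by simp [lsum]
  | a + 1, f => by
    simp only [lsum, bval_cons, Bool.toNat_false, Bool.toNat_true, Nat.zero_add]
    rw [lsum_bval a (fun u => f (2 * u)), lsum_bval a (fun u => f (1 + 2 * u)), pow_succ]
    induction 2 ^ a with
    | zero => simp
    | succ n ih =>
      rw [Finset.sum_range_succ, Finset.sum_range_succ,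
        show (n + 1) * 2 = n * 2 + 1 + 1 by ring, Finset.sum_range_succ, Finset.sum_range_succ, ← ih,
        show n * 2 + 1 = 1 + 2 * n by ring, show n * 2 = 2 * n by ring]
      ring

/-! ### The analysis: step classes -/

/-- The three classes of a step: the designated (good) slot, a lazy slot `u ≥ k`, another slot.
[cite: SchoeningFOCS1999, Theorem (proof: "moves in the right direction with probability ≥ 1/k")] -/
inductive Cls
  | good
  | lazy
  | other
  deriving DecidableEq

/-- The class of the number `u` when the designated slot is `ds` (`< k`). [folklore] -/
def clsOf (k ds u : ℕ) : Cls := if u = ds then .good else if k ≤ u then .lazy else .other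

/-- The number of `u < N` in each class: `1`, `N - k`, `k - 1`. [folklore] -/
def Cls.size (k N : ℕ) : Cls → ℕ
  | .good => 1
  | .lazy => N - k
  | .other => k - 1

/-- The weight of a class word: the number of `u`-sequences realising it. [folklore] -/
def weight (k N : ℕ) (ρ : List Cls) : ℕ := (ρ.map (Cls.size k N)).prod

/-- Weight of nil. [folklore] -/
@[simp] theorem weight_nil (k N : ℕ) : weight k N [] = 1 := rfl
/-- Weight of a cons. [folklore] -/
@[simp] theorem weight_cons (k N : ℕ) (x : Cls) (ρ : List Cls) :
    weight k N (x :: ρ) = x.size k N * weight k N ρ := rfl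
/-- Weight is multiplicative. [folklore] -/
theorem weight_append (k N : ℕ) (ρ₁ ρ₂ : List Cls) :
    weight k N (ρ₁ ++ ρ₂) = weight k N ρ₁ * weight k N ρ₂ := by
  simp [weight, List.prod_append]

/-- **Class sizes do not depend on the designated slot**: summing `g ∘ clsOf k ds` over `u < N`
gives `g good + (N - k) · g lazy + (k - 1) · g other`, for `ds < k ≤ N`. [folklore] -/
theorem sum_range_clsOf {k N ds : ℕ} (hds : ds < k) (hkN : k ≤ N) (g : Cls → ℕ) :
    ∑ u ∈ Finset.range N, g (clsOf k ds u) =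
      g .good * Cls.size k N .good + g .lazy * Cls.size k N .lazy + g .other * Cls.size k N .other := by
  simp only [Cls.size]
  rw [Finset.range_eq_Ico, ← Finset.sum_Ico_consecutive _ (Nat.zero_le k) hkN]
  have h1 : ∑ u ∈ Finset.Ico 0 k, g (clsOf k ds u) = g .good + (k - 1) * g .other := by
    have : ∀ u ∈ Finset.Ico 0 k, g (clsOf k ds u) = if u = ds then g .good else g .other := by
      intro u hu
      rw [Finset.mem_Ico] at hu
      unfold clsOf
      by_cases h : u = ds
      · simp [h]
      · rw [if_neg h, if_neg (by omega), if_neg h]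
    rw [Finset.sum_congr rfl this, Finset.sum_ite, Finset.sum_const, Finset.sum_const]
    have hf : (Finset.Ico 0 k).filter (fun u => u = ds) = {ds} := by
      ext u; simp only [Finset.mem_filter, Finset.mem_Ico, Finset.mem_singleton]; omega
    have hf' : ((Finset.Ico 0 k).filter (fun u => ¬ u = ds)).card = k - 1 := by
      have := Finset.card_filter_add_card_filter_not (s := Finset.Ico 0 k) (fun u => u = ds)
      rw [hf, Finset.card_singleton, Nat.card_Ico] at this
      omega
    rw [hf, hf', Finset.card_singleton]
    simp
  have h2 : ∑ u ∈ Finset.Ico k N, g (clsOf k ds u) = (N - k) * g .lazy := by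
    have : ∀ u ∈ Finset.Ico k N, g (clsOf k ds u) = g .lazy := by
      intro u hu
      rw [Finset.mem_Ico] at hu
      unfold clsOf
      rw [if_neg (by omega), if_pos hu.1]
    rw [Finset.sum_congr rfl this, Finset.sum_const, Nat.card_Ico]
    simp
  rw [h1, h2]
  ring

/-! ### Sums over all class words of a given length -/

/-- `wsum m F`: the sum of `F ρ` over all class words `ρ` of length `m`. [folklore] -/
def wsum : ℕ → (List Cls → ℕ) → ℕ
  | 0, F => F []
  | m + 1, F => wsum m (fun ρ => F (.good :: ρ)) + wsum m (fun ρ => F (.lazy :: ρ)) +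
      wsum m (fun ρ => F (.other :: ρ))

/-- `wsum` is monotone. [folklore] -/
theorem wsum_mono : ∀ {m : ℕ} {F G : List Cls → ℕ}, (∀ ρ, ρ.length = m → F ρ ≤ G ρ) →
    wsum m F ≤ wsum m G
  | 0, F, G, h => h [] rfl
  | m + 1, F, G, h => by
    simp only [wsum]
    exact Nat.add_le_add (Nat.add_le_add (wsum_mono fun ρ hρ => h _ (by simp [hρ]))
      (wsum_mono fun ρ hρ => h _ (by simp [hρ]))) (wsum_mono fun ρ hρ => h _ (by simp [hρ]))

/-- `wsum` only looks at words of the right length. [folklore] -/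
theorem wsum_congr {m : ℕ} {F G : List Cls → ℕ} (h : ∀ ρ, ρ.length = m → F ρ = G ρ) :
    wsum m F = wsum m G :=
  le_antisymm (wsum_mono fun ρ hρ => (h ρ hρ).le) (wsum_mono fun ρ hρ => (h ρ hρ).ge)

/-- Constants come out of `wsum`. [folklore] -/
theorem wsum_mul : ∀ (m c : ℕ) (F : List Cls → ℕ), wsum m (fun ρ => c * F ρ) = c * wsum m F
  | 0, c, F => rfl
  | m + 1, c, F => by
    simp only [wsum]
    rw [wsum_mul m, wsum_mul m, wsum_mul m]
    ring

/-- Splitting words: `wsum (m₁ + m₂) F = Σ_{ρ₁} Σ_{ρ₂} F (ρ₁ ++ ρ₂)`. [folklore] -/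
theorem wsum_add : ∀ (m₁ m₂ : ℕ) (F : List Cls → ℕ),
    wsum (m₁ + m₂) F = wsum m₁ (fun ρ₁ => wsum m₂ (fun ρ₂ => F (ρ₁ ++ ρ₂)))
  | 0, m₂, F => by simp [wsum]
  | m₁ + 1, m₂, F => by
    rw [show m₁ + 1 + m₂ = (m₁ + m₂) + 1 by omega]
    simp only [wsum]
    rw [wsum_add m₁ m₂, wsum_add m₁ m₂, wsum_add m₁ m₂]
    rfl

/-- **The total weight of all words of length `m` is `N^m`** (`1 + (N - k) + (k - 1) = N`).
[folklore] -/
theorem wsum_weight {k N : ℕ} (hk : 1 ≤ k) (hkN : k ≤ N) :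
    ∀ m : ℕ, wsum m (weight k N) = N ^ m
  | 0 => rfl
  | m + 1 => by
    simp only [wsum, weight_cons]
    rw [wsum_mul, wsum_mul, wsum_mul, wsum_weight hk hkN m, pow_succ]
    simp only [Cls.size]
    zify [hk, hkN]
    ring

end Literature.Computability.FineGrained.SchoeningCoin
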